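import Summits.HodgeConjecture.HodgeConjecture.Theses.DerivedTorelliFermat

/-!
# Birth skeleton (BC3) of the crux `ResidualSectorComplement` — route `DerivedTorelliFermat`

Crux item `stmt-HodgeConjecture-13828` (rank 9, declared NOT-claimed frame of a sector route), decl
`Summit.HodgeConjecture.HodgeConjecture.Theses.DerivedTorelliFermat.ResidualSectorComplement`:

  `ResidualSectorComplement := FermatFourfoldsHCModResidual → _root_.HodgeConjecture`

i.e. "the repaired target (HC for every smooth projective Fermat fourfold `X⁴ₘ`, `m ≥ 1`, GRANTED
that its residual eigenlines are algebraic) implies the Hodge conjecture". Registrar skeleton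
(`skeleton-register`, planner one-shot; no Disproof.lean, no dead lines on this crux yet).

## Anatomy of the crux (the seam)

The route header names the content of this item exactly: "Besides HC off the Fermat fourfolds it
now contains the RESIDUAL SECTOR named by the refutation of K3Exhaustion". Reading the target's
hypothesis `hR` off `FermatFourfoldsHCModResidual` (per degree `m`: every Hodge character `α` of
`X⁴ₘ` that is neither Shioda–Aoki reachable nor realisable-K3-sector has `V(α) ⊆ N²H⁴`), the crux is
the conjunction of three mathematically distinct pieces, and the skeleton cuts along them:

* `stub_nonRealisableK3Sector` — RESIDUAL SECTOR (a), the K3-type part beyond K3 rank: `α` Hodge,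
  not reachable, not realisable-K3, but `α ∼ β#γ` with `β` K3-type admissible whose unit orbit has
  MORE than 21 elements (rank `V[β] = φ(d′) > 21`; by the refuter census to `m = 200` these are the
  `φ = 24` orbits of orders `d′ ∈ {35, 45, 70, 90}`; first instance `m = 70`, the unit orbit of
  `{1,20,24,42,61,62}`, 24 sextuples) ⇒ `V(α)` algebraic. These are accidental Hodge isomorphisms
  between K3-type CM pieces of `H²(S_m)` of rank > 21, which NO projective K3 surface carries
  (rank `T(Y) ≤ 21`; LivneSchuttYui2010 / Machida–Oguiso: no purely non-symplectic automorphism of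
  these orders); the natural carriers are CM abelian varieties (Shioda–Katsura domination of `S_m`
  by `C_m × C_m`, van Geemen's half twist) — Weil-type classes. OPEN.
* `stub_higherGenusResidual` — RESIDUAL SECTOR (b), higher genus: `α` Hodge, not reachable and
  admitting NO K3-type split of any rank (no `α ∼ β#γ` with `β` admissible of K3 type and
  `β₃ + γ₃ = 0`; first instances `m = 110`: the unit orbits of `{1,24,62,71,81,91}`,
  `{1,31,55,71,81,91}` = the refutation witnesses of `K3Exhaustion`, every 3+3 split of which pairs
  CM pieces of `H²(S₁₁₀)` with `h²·⁰ = 2`; `m = 114`: three orbits — da Silva's "candidates for a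
  counter-example") ⇒ `V(α)` algebraic. By André's CM remark these are sums of pullbacks of Weil classes on CM abelian
  varieties of Weil type with `K ⊂ ℚ(ζₘ)`; the only unconditional engine is Markman's secant-sheaf
  construction, for sixfolds of split Weil type (arXiv:2502.03415, arXiv:2509.23403). OPEN.
* `stub_summitGrantedFermatFourfolds` — THE COMPLEMENT PROPER: the Hodge conjecture granted HC for
  every smooth projective Fermat fourfold of positive degree (verbatim the route's rev-0 frame
  `FourfoldSectorComplement`, stmt-HodgeConjecture-11126, which was restated INTO this crux at rev 3
  when the residual sector was added). Declared, NOT claimed; conjecture-grade (it is `HC ∨ ¬HC(X⁴)`,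
  so not summit-equivalent on its own). OPEN.
* `ResidualSectorComplement_of` (no `sorry`): stubs (a) + (b) discharge the residual hypothesis of
  the target degree by degree (classical trichotomy on the K3-type splits of `α`: a split with a
  unit orbit of size ≤ 21 contradicts "not realisable-K3"; a split with all orbit bounds > 21 is
  sector (a); no split at all is sector (b)), the target then gives HC for all Fermat fourfolds of
  positive degree, and stub (c) concludes the route decl BY NAME.

Neither stub alone gives the crux ((a)/(b) say nothing off `X⁴ₘ`; (c) lacks the residual) nor the
summit; BC3 probes (`stub → ResidualSectorComplement`, `stub → _root_.HodgeConjecture` by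
`first | exact? | simpa using h | aesop` and an unfolded variant) are run in sibling probe files
(registrar folder `bc/`) and must fail. `sorry` occurs only inside the three `stub_*` theorems.

All statements are spelled over existing declarations only, with the route file's INLINE
eigenspace predicate (`V(α)` = simultaneous eigenspace of the diagonal μₘ⁶-action on
`H⁴(V₊(Σxᵢᵐ)(ℂ);ℂ)`, rev 5 spelling), copied verbatim so that the glue is syntactic.
-/

set_option linter.dupNamespace false

namespace Summit.HodgeConjecture.HodgeConjecture.Cruxes.ResidualSectorComplement.Birth

open Summit.HodgeConjecture.HodgeConjecture.Theses.DerivedTorelliFermat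

/-- **Stub (a) statement — the non-realisable K3-type residual sector is algebraic.** For every
`m ≥ 1` and every Hodge character `α` of `X⁴ₘ` that is NOT Shioda–Aoki reachable and NOT
realisable-K3-sector (the two negated clauses of the target, verbatim), IF `α ∼ β#γ` with `β`
admissible K3-type (exactly one unit multiple of Hodge level `Σ⟨δᵢ⟩ = m`) whose unit orbit is
contained in no finset of size ≤ 21 (rank `V[β] = φ(d′) > 21`; `= 24` in every census instance) and
`β₃ + γ₃ = 0`, THEN the eigenline `V(α) ⊂ H⁴(V₊(Σxᵢᵐ)(ℂ);ℂ)` consists of algebraic classes. First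
instance `m = 70` (orders 35/70; the negated realisable clause is kept so that a character with a
second, realisable split stays in the route's crux `K3SectorAlgebraic`). [cite: Shioda1979HodgeFermat] [cite: LivneSchuttYui2010] [cite: arXiv:2502.03415] -/
def NonRealisableK3SectorAlgebraic : Prop :=
  ∀ (m : ℕ) [NeZero m] (α : Fin (2 * 2 + 2) → ZMod m), Literature.AlgebraicGeometry.HodgeTheory.FermatCharacter.IsHodge α → ¬ (∃ (Q : Multiset (ZMod m)) (parts : Multiset (Multiset (ZMod m))), (∀ κ ∈ parts, (Literature.AlgebraicGeometry.HodgeTheory.FermatCharacter.IsHodgeMultiset κ ∧ Multiset.card κ ≤ 4) ∨ (Literature.AlgebraicGeometry.HodgeTheory.FermatCharacter.IsHodgeMultiset κ ∧ Literature.AlgebraicGeometry.HodgeTheory.FermatCharacter.IsSemiDecomposable κ) ∨ (∃ (p r : ℕ) (a : ZMod m), p.Prime ∧ p = 2 * r + 1 ∧ p ∣ m ∧ 2 * Nat.gcd a.val (m / p) < m / p ∧ κ = (Multiset.range p).map (fun k : ℕ => a + (k : ZMod m) * ((m / p : ℕ) : ZMod m)) + {-((p : ZMod m) * a)})) ∧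 Finset.univ.val.map α + (Q + Q.map fun a => -a) = parts.sum) → ¬ (∃ β γ : Fin 4 → ZMod m, ((∀ i, β i ≠ 0) ∧ ∑ i, β i = 0 ∧ ∃! δ : Fin 4 → ZMod m, (∃ t : (ZMod m)ˣ, δ = fun i => (t : ZMod m) * β i) ∧ Literature.AlgebraicGeometry.HodgeTheory.FermatCharacter.normSum δ = m) ∧ (∃ O : Finset (Fin 4 → ZMod m), O.card ≤ 21 ∧ ∀ t : (ZMod m)ˣ, (fun i => (t : ZMod m) * β i) ∈ O) ∧ β 3 + γ 3 = 0 ∧ Finset.univ.val.map α = ({β 0, β 1, β 2} + {γ 0, γ 1, γ 2} : Multiset (ZMod m))) → (∃ β γ : Fin 4 → ZMod m, ((∀ i, β i ≠ 0) ∧ ∑ i, β i = 0 ∧ ∃! δ : Fin 4 → ZMod m, (∃ t : (ZMod m)ˣ, δ = fun i => (t : ZMod m) * β i) ∧ Literature.AlgebraicGeometry.HodgeTheory.FermatCharacter.normSum δ = m) ∧ (∀ O : Finset (Fin 4 → ZMod m), (∀ t : (ZMod m)ˣ, (fun i => (t : ZMod m) * β i) ∈ O) → 21 < O.card) ∧ β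 3 + γ 3 = 0 ∧ Finset.univ.val.map α = ({β 0, β 1, β 2} + {γ 0, γ 1, γ 2} : Multiset (ZMod m))) → ∀ c : Literature.AlgebraicGeometry.HodgeTheory.complexBetti (Literature.AlgebraicGeometry.Motives.SmoothHypersurface.hypersurface (Literature.AlgebraicGeometry.Motives.fermatPolynomial ℂ (2 * 2) m)) (2 * 2), (∀ (a : Fin (2 * 2 + 2) → ℂˣ) (ha : a ∈ Literature.AlgebraicGeometry.HodgeTheory.diagonalStabilizer (Literature.AlgebraicGeometry.Motives.fermatPolynomial ℂ (2 * 2) m)), (∀ i, a i ^ m = 1) → Literature.AlgebraicTopology.SingularHomology.singularCohomology.map ℂ ℂ (Literature.AlgebraicGeometry.HodgeTheory.diagonalMap (Literature.AlgebraicGeometry.Motives.fermatPolynomial ℂ (2 * 2) m) ha) (2 * 2) c = (∏ i, (a i : ℂ) ^ (α i).val) • c) → c ∈ Literature.AlgebraicGeometry.HodgeTheory.algebraicClasses (Literature.AlgebraicGeometry.Motives.SmoothHypersurface.hypersurface (Literature.AlgebraicGeometry.Motives.fermatPolynomial ℂ (2 * 2) m)) 2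

/-- **Stub (b) statement — the higher-genus residual sector is algebraic.** For every `m ≥ 1` and
every Hodge character `α` of `X⁴ₘ` that is NOT Shioda–Aoki reachable (verbatim the target's clause)
and admits NO K3-type split of any rank (no `α ∼ β#γ` with `β` admissible K3-type and
`β₃ + γ₃ = 0` — e.g. every 3+3 split pairs CM pieces with `h²·⁰ ≠ 1`), the eigenline `V(α)` consists
of algebraic classes. First instances `m = 110` (the two unit orbits refuting `K3Exhaustion`),
`m = 114` (three orbits). [cite: arXiv:2101.04739] [cite: arXiv:2502.03415] [cite: arXiv:2509.23403] -/
def HigherGenusResidualAlgebraic : Prop :=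
  ∀ (m : ℕ) [NeZero m] (α : Fin (2 * 2 + 2) → ZMod m), Literature.AlgebraicGeometry.HodgeTheory.FermatCharacter.IsHodge α → ¬ (∃ (Q : Multiset (ZMod m)) (parts : Multiset (Multiset (ZMod m))), (∀ κ ∈ parts, (Literature.AlgebraicGeometry.HodgeTheory.FermatCharacter.IsHodgeMultiset κ ∧ Multiset.card κ ≤ 4) ∨ (Literature.AlgebraicGeometry.HodgeTheory.FermatCharacter.IsHodgeMultiset κ ∧ Literature.AlgebraicGeometry.HodgeTheory.FermatCharacter.IsSemiDecomposable κ) ∨ (∃ (p r : ℕ) (a : ZMod m), p.Prime ∧ p = 2 * r + 1 ∧ p ∣ m ∧ 2 * Nat.gcd a.val (m / p) < m / p ∧ κ = (Multiset.range p).map (fun k : ℕ => a + (k : ZMod m) * ((m / p : ℕ) : ZMod m)) + {-((p : ZMod m) * a)})) ∧ Finset.univ.val.map α + (Q + Q.map fun a => -a) = parts.sum) → ¬ (∃ β γ : Fin 4 → ZMod m, ((∀ i, β i ≠ 0) ∧ ∑ i, β i = 0 ∧ ∃! δ : Fin 4 → ZMod m, (∃ t : (ZMod m)ˣ, δ = fun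 i => (t : ZMod m) * β i) ∧ Literature.AlgebraicGeometry.HodgeTheory.FermatCharacter.normSum δ = m) ∧ β 3 + γ 3 = 0 ∧ Finset.univ.val.map α = ({β 0, β 1, β 2} + {γ 0, γ 1, γ 2} : Multiset (ZMod m))) → ∀ c : Literature.AlgebraicGeometry.HodgeTheory.complexBetti (Literature.AlgebraicGeometry.Motives.SmoothHypersurface.hypersurface (Literature.AlgebraicGeometry.Motives.fermatPolynomial ℂ (2 * 2) m)) (2 * 2), (∀ (a : Fin (2 * 2 + 2) → ℂˣ) (ha : a ∈ Literature.AlgebraicGeometry.HodgeTheory.diagonalStabilizer (Literature.AlgebraicGeometry.Motives.fermatPolynomial ℂ (2 * 2) m)), (∀ i, a i ^ m = 1) → Literature.AlgebraicTopology.SingularHomology.singularCohomology.map ℂ ℂ (Literature.AlgebraicGeometry.HodgeTheory.diagonalMap (Literature.AlgebraicGeometry.Motives.fermatPolynomial ℂ (2 * 2) m) ha) (2 * 2) c = (∏ i, (a i : ℂ) ^ (α i).val) • c) → c ∈ Literature.AlgebraicGeometry.HodgeTheory.algebraicClasses (Literature.AlgebraicGeometry.Motives.SmoothHypersurface.hypersurface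 (Literature.AlgebraicGeometry.Motives.fermatPolynomial ℂ (2 * 2) m)) 2

/-- **Stub (c) statement — the summit granted the Fermat fourfolds** (the complement proper of the
route's sector; verbatim the rev-0 frame `FourfoldSectorComplement` = stmt-HodgeConjecture-11126 of
this route with `[NeZero m]` for `0 < m`): IF the Hodge conjecture holds for every smooth projective
Fermat fourfold `X ≅ V₊(Σᵢ₌₀⁵ xᵢᵐ)`, `m ≥ 1`, THEN it holds for every smooth projective complex
variety. Declared, NOT claimed (`= HC ∨ ¬HC(Fermat fourfolds)`). [cite: Deligne2000, §1] -/
def SummitGrantedFermatFourfolds : Prop :=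
  (∀ (m : ℕ) [NeZero m] (X : Literature.AlgebraicGeometry.Motives.SchemeOver ℂ), Literature.AlgebraicGeometry.Motives.IsFermatVariety 4 m X → Literature.AlgebraicGeometry.Motives.IsSmoothProjective 4 X → Literature.AlgebraicGeometry.HodgeTheory.HodgeConjectureFor 4 X) → _root_.HodgeConjecture

/-- Stub (a): accidental Hodge isomorphisms between RANK-24 K3-type pieces of `H²(S_m)` pushed to
`X⁴ₘ` are algebraic (first instance `m = 70`). OPEN. [cite: LivneSchuttYui2010] [cite: arXiv:2502.03415] -/
theorem stub_nonRealisableK3Sector : NonRealisableK3SectorAlgebraic := by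
  sorry

/-- Stub (b): non-reachable Hodge characters of `X⁴ₘ` with no K3-type split (higher-genus accidental
Hodge morphisms; first instances `m = 110, 114`) have algebraic eigenlines. OPEN.
[cite: arXiv:2101.04739] [cite: arXiv:2502.03415] -/
theorem stub_higherGenusResidual : HigherGenusResidualAlgebraic := by
  sorry

/-- Stub (c): the Hodge conjecture granted HC for all smooth projective Fermat fourfolds of positive
degree (declared, NOT claimed complement of the sector). OPEN. [cite: Deligne2000, §1] -/
theorem stub_summitGrantedFermatFourfolds : SummitGrantedFermatFourfolds := by
  sorry

/-! ## Name-keyed aliases of the three statements — the hypotheses of `ResidualSectorComplement_of`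
The native skeleton audit (`#h21_check_skeleton`) admits a `Prop` hypothesis of the skeleton theorem
only if its head constant is a registered obligation or is NAMED like a declared stub;
`__Registered.stub_X` is statement `X` under the registered stub's short name (device of
`Cruxes/AlgebraicDensity/Lines/birth.lean`; the audit's stub report resolves each `stub_…` to the
sorried theorem above, not to its alias). -/
namespace __Registered

/-- Alias of `NonRealisableK3SectorAlgebraic` keyed by the registered stub name. -/
abbrev stub_nonRealisableK3Sector : Prop := NonRealisableK3SectorAlgebraic
/-- Alias of `HigherGenusResidualAlgebraic` keyed by the registered stub name. -/
abbrev stub_higherGenusResidual : Prop := HigherGenusResidualAlgebraic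
/-- Alias of `SummitGrantedFermatFourfolds` keyed by the registered stub name. -/
abbrev stub_summitGrantedFermatFourfolds : Prop := SummitGrantedFermatFourfolds

end __Registered

/-- **Composition (real proof) — THE SKELETON THEOREM.** The two residual sectors (a), (b)
discharge, degree by degree, the residual hypothesis of the target `FermatFourfoldsHCModResidual`
(classical trichotomy on the K3-type splits `α ∼ β#γ` of a non-reachable, non-realisable Hodge
character: a split with a unit-orbit bound `≤ 21` contradicts non-realisability; a split all of
whose orbit bounds exceed 21 is sector (a); no split is sector (b)); the target then yields HC for
every smooth projective Fermat fourfold of positive degree, and the complement (c) concludes the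
route decl `DerivedTorelliFermat.ResidualSectorComplement` BY NAME. -/
theorem ResidualSectorComplement_of :
    __Registered.stub_nonRealisableK3Sector → __Registered.stub_higherGenusResidual →
      __Registered.stub_summitGrantedFermatFourfolds →
        Summit.HodgeConjecture.HodgeConjecture.Theses.DerivedTorelliFermat.ResidualSectorComplement := by
  intro hA hB hC hT
  -- (c): it suffices to prove HC for every smooth projective Fermat fourfold of positive degree
  apply hC
  intro m _ X hF hX
  -- the target, once its residual hypothesis at degree `m` is discharged by (a) and (b)
  refine hT m ?_ X hF hX
  intro α hα hnr hnk c hc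
  refine (Classical.em _).elim (fun hbig => hA m α hα hnr hnk hbig c hc) fun hbig => hB m α hα hnr ?_ c hc
  -- no K3-type split at all: a split is either realisable (orbit bound ≤ 21) or in sector (a)
  rintro ⟨β, γ, hk3, h3, hms⟩
  refine (Classical.em _).elim (fun hO => hnk ⟨β, γ, hk3, hO, h3, hms⟩) fun hO => hbig ⟨β, γ, hk3, ?_, h3, hms⟩
  intro O hOmem
  exact not_le.mp fun hle => hO ⟨O, hle, hOmem⟩

/-- **The crux, closed modulo exactly the three registered stubs** (sanity: the stubs compose; its
closure is conditional on the `stub_*` placeholders until they are proved). -/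
theorem ResidualSectorComplement_of_stubs :
    Summit.HodgeConjecture.HodgeConjecture.Theses.DerivedTorelliFermat.ResidualSectorComplement :=
  ResidualSectorComplement_of stub_nonRealisableK3Sector stub_higherGenusResidual
    stub_summitGrantedFermatFourfolds

end Summit.HodgeConjecture.HodgeConjecture.Cruxes.ResidualSectorComplement.Birth
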